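import Summits.ValiantsHypothesis.ValiantsHypothesis.Theorems.LacunarySymmetroidMatrixDescartesDoorA26WallBubblingBalanceCount

/-!
# `DoorA26` / line `wall_bubbling` — MIXED KIT I: sign-word functions vanish at their change points; pairing lemmas with FORCED ZEROS
(the restricted Chebyshev alternation needed when rank-ZERO nodes are present)

HONEST FRAMING.  Object-search cell `pub-symmetroid`, crux `Theses.LacunarySymmetroid.DoorA26` (stmt-ValiantsHypothesis-19979; OPEN, typed,
never asserted).  W2 seat val-sym-door-p1 g19; def-free helper for obligation (R) of `Cruxes/DoorA26/Lines/wall_bubbling.lean`.  File #58 of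
the MIXED chain #58–#63 (rank-one touches AND rank-zero nodes), which extends #53–#57 (rank-one only).  Imports #48 `…BalanceCount` only.

WHAT IS HERE.  `signWord_zero_at` (a continuous `φ` with `0 < ∏(u_i − t)·φ(t)` off the change points VANISHES at each change point), ★
`eq_zero_of_pairing_signWord` (a vector `b` on abscissae `A`, sign word cut by `q < K` change points `u`, and `Σ_j b_j φ(τ_j) = 0` for every `K`-term
sum `φ` vanishing AT ALL change points ⇒ `b = 0`; pair with #46's sign-word function, which vanishes at its change points), ★ `eq_zero_of_pairing_small`
(`b` on `A`, nodes `Z` disjoint from `A`, `|A| + |Z| ≤ K`, `Σ_j b_j φ(τ_j) = 0` for every `φ` vanishing on the nodes ⇒ `b = 0`; interpolate with #45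
`exists_expSum_interpolate`).  These replace #48's two kernel-vector lemmas when the test functions are RESTRICTED to sums vanishing at the rank-zero
nodes.  Nothing here bears on `DoorA26`, `DoorA34`, (W)/(M)/(R) as typed, `MatrixDescartes` (18050) or `VP ≠ VNP`; registers unchanged.

[folklore] Chebyshev/Haar property of real exponentials.  [this work] the packaging.
-/

set_option linter.dupNamespace false

namespace Summit.ValiantsHypothesis.ValiantsHypothesis.Theorems.LacunarySymmetroidMatrixDescartes.WallBubbling

open Finset Filter Topology
open Bubbling (polar)

/-! ## §1 Sign-word functions vanish at their change points; pairing with forced zeros -/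

/-- A continuous function whose product with `∏ (u_i − t)` is positive off the change points vanishes AT every change point
(its sign flips there). [folklore] -/
theorem signWord_zero_at {q : ℕ} (u : Fin q → ℝ) (hu : Function.Injective u) (φ : ℝ → ℝ) (hφ : Continuous φ)
    (hpos : ∀ t, (∀ i, t ≠ u i) → 0 < (∏ i, (u i - t)) * φ t) (i₀ : Fin q) : φ (u i₀) = 0 := by
  classical
  by_contra hne
  set R : ℝ → ℝ := fun t => ∏ i ∈ Finset.univ.erase i₀, (u i - t) with hR
  have hRc : Continuous R := continuous_finsetProd _ fun i _ => continuous_const.sub continuous_id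
  have hR0 : R (u i₀) ≠ 0 :=
    Finset.prod_ne_zero_iff.2 fun i hi => sub_ne_zero.2 (fun h => (Finset.mem_erase.1 hi).1 (hu h))
  have hsplit : ∀ t, (∏ i, (u i - t)) = (u i₀ - t) * R t := fun t => by
    rw [hR, ← Finset.mul_prod_erase Finset.univ (fun i => u i - t) (Finset.mem_univ i₀)]
  have hc0 : R (u i₀) * φ (u i₀) ≠ 0 := mul_ne_zero hR0 hne
  have hev : ∀ᶠ t in 𝓝 (u i₀), 0 < (R (u i₀) * φ (u i₀)) * (R t * φ t) := by
    have : 0 < (R (u i₀) * φ (u i₀)) * (R (u i₀) * φ (u i₀)) := mul_self_pos.2 hc0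
    exact ((hRc.mul hφ).continuousAt.const_mul _).eventually (isOpen_Ioi.mem_nhds this)
  have hev2 : ∀ᶠ t in 𝓝 (u i₀), ∀ i, i ≠ i₀ → t ≠ u i := by
    refine Filter.eventually_all.2 fun i => ?_
    by_cases hi : i = i₀
    · exact Filter.Eventually.of_forall fun t h => (h hi).elim
    · have hne' : u i₀ ≠ u i := fun h => hi (hu h).symm
      exact Filter.eventually_of_mem (isOpen_ne.mem_nhds hne') fun t ht _ => ht
  obtain ⟨ε, hε, hball⟩ := Metric.eventually_nhds_iff.1 (hev.and hev2)
  have hmem : ∀ s : ℝ, |s| < ε → dist (u i₀ + s) (u i₀) < ε := fun s hs => by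
    rw [Real.dist_eq]; simpa using hs
  have hplus := hball (hmem (ε / 2) (by rw [abs_of_pos (half_pos hε)]; linarith))
  have hminus := hball (hmem (-(ε / 2)) (by rw [abs_neg, abs_of_pos (half_pos hε)]; linarith))
  have hneplus : ∀ i, u i₀ + ε / 2 ≠ u i := fun i => by
    by_cases hi : i = i₀
    · subst hi; linarith
    · exact hplus.2 i hi
  have hneminus : ∀ i, u i₀ + -(ε / 2) ≠ u i := fun i => by
    by_cases hi : i = i₀
    · subst hi; linarith
    · exact hminus.2 i hi
  have hpplus := hpos _ hneplus
  have hpminus := hpos _ hneminus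
  rw [hsplit] at hpplus hpminus
  -- signs: at `u i₀ + ε/2` the factor `(u i₀ − t) = −ε/2 < 0`, at `u i₀ − ε/2` it is `ε/2 > 0`
  have eplus : (u i₀ - (u i₀ + ε / 2)) = -(ε / 2) := by ring
  have eminus : (u i₀ - (u i₀ + -(ε / 2))) = ε / 2 := by ring
  rw [eplus] at hpplus
  rw [eminus] at hpminus
  have splus : R (u i₀ + ε / 2) * φ (u i₀ + ε / 2) < 0 := by nlinarith
  have sminus : 0 < R (u i₀ + -(ε / 2)) * φ (u i₀ + -(ε / 2)) := by nlinarith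
  have := hplus.1
  have := hminus.1
  nlinarith

/-- **Pairing with forced zeros (discrete Chebyshev alternation, restricted form).**  Increasing exponents `δ : Fin K`, `q < K`
increasing change points `u`, a vector `b` supported on `A` (abscissae `τ`, none of them a change point) with `0 ≤ b_j ∏(u_i − τ_j)`, and
the PAIRING hypothesis: `Σ_j b_j φ(τ_j) = 0` for every `K`-term sum `φ` VANISHING AT ALL CHANGE POINTS.  Then `b = 0`.  (Pair with the
sign-word function of #46, which vanishes at its change points.) [folklore] -/
theorem eq_zero_of_pairing_signWord {K N q : ℕ} (δ : Fin K → ℝ) (hd : StrictMono δ) (hq : q < K) (u : Fin q → ℝ)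
    (hu : StrictMono u) (τ : Fin N → ℝ) (A : Finset (Fin N)) (b : Fin N → ℝ) (hbA : ∀ j ∉ A, b j = 0)
    (hsign : ∀ j ∈ A, (∀ i, τ j ≠ u i) ∧ 0 ≤ b j * ∏ i, (u i - τ j))
    (hpair : ∀ c : Fin K → ℝ, (∀ i, ∑ l, c l * Real.exp (δ l * u i) = 0) →
      ∑ j, b j * (∑ l, c l * Real.exp (δ l * τ j)) = 0) : ∀ j, b j = 0 := by
  classical
  obtain ⟨c, hc⟩ := exists_expSum_signWord δ hd hq u hu
  have hφc : Continuous (fun t => ∑ l, c l * Real.exp (δ l * t)) :=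
    continuous_finsetSum _ fun l _ => continuous_const.mul (Real.continuous_exp.comp (continuous_const.mul continuous_id))
  have hzero : ∀ i, ∑ l, c l * Real.exp (δ l * u i) = 0 := fun i =>
    signWord_zero_at u hu.injective _ hφc hc i
  have hsum := hpair c hzero
  have hnn : ∀ j, 0 ≤ b j * (∑ l, c l * Real.exp (δ l * τ j)) := by
    intro j
    by_cases hj : j ∈ A
    · obtain ⟨hne, hs⟩ := hsign j hj
      have hφ := hc (τ j) hne
      have hP2 : 0 < (∏ i, (u i - τ j)) ^ 2 := by
        have : (∏ i, (u i - τ j)) ≠ 0 := Finset.prod_ne_zero_iff.2 fun i _ => sub_ne_zero.2 (hne i).symm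
        positivity
      have h := mul_nonneg hs hφ.le
      have hre : b j * (∏ i, (u i - τ j)) * ((∏ i, (u i - τ j)) * ∑ l, c l * Real.exp (δ l * τ j))
          = (b j * ∑ l, c l * Real.exp (δ l * τ j)) * (∏ i, (u i - τ j)) ^ 2 := by ring
      rw [hre] at h
      exact (mul_nonneg_iff_of_pos_right hP2).1 h
    · rw [hbA j hj, zero_mul]
  have hz := (Finset.sum_eq_zero_iff_of_nonneg (fun j _ => hnn j)).1 hsum
  intro j
  by_cases hj : j ∈ A
  · obtain ⟨hne, -⟩ := hsign j hj
    have hφ := hc (τ j) hne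
    have hφne : (∑ l, c l * Real.exp (δ l * τ j)) ≠ 0 := by
      intro h0; rw [h0, mul_zero] at hφ; exact lt_irrefl _ hφ
    rcases mul_eq_zero.1 (hz j (Finset.mem_univ j)) with h | h
    · exact h
    · exact absurd h hφne
  · exact hbA j hj

/-- **Pairing with forced zeros, small support.**  If `b` is supported on `A`, the node indices `Z` are disjoint from `A`,
`|A| + |Z| ≤ K`, and `Σ_j b_j φ(τ_j) = 0` for every `K`-term sum `φ` vanishing at the nodes `τ(Z)`, then `b = 0` (interpolate: `φ = b`
on `A`, `0` on `Z`, anything at `K − |A| − |Z|` fresh points). [folklore] -/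
theorem eq_zero_of_pairing_small {K N : ℕ} (δ : Fin K → ℝ) (hd : StrictMono δ) (τ : Fin N → ℝ) (hτ : StrictMono τ)
    (A Z : Finset (Fin N)) (hAZ : Disjoint A Z) (hcard : A.card + Z.card ≤ K) (b : Fin N → ℝ) (hbA : ∀ j ∉ A, b j = 0)
    (hpair : ∀ c : Fin K → ℝ, (∀ i ∈ Z, ∑ l, c l * Real.exp (δ l * τ i) = 0) →
      ∑ j, b j * (∑ l, c l * Real.exp (δ l * τ j)) = 0) : ∀ j, b j = 0 := by
  classical
  by_cases hA : A = ∅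
  · intro j; exact hbA j (by rw [hA]; exact Finset.notMem_empty j)
  obtain ⟨j₀, hj₀⟩ := Finset.nonempty_iff_ne_empty.2 hA
  set Y : Finset (Fin N) := A ∪ Z with hY
  have hYne : Y.Nonempty := ⟨j₀, Finset.mem_union_left _ hj₀⟩
  have hYcard : Y.card ≤ K := by rw [hY, Finset.card_union_of_disjoint hAZ]; exact hcard
  set kY := Y.card with hkY
  let e : Fin kY ↪o Fin N := Y.orderEmbOfFin rfl
  set M : ℝ := τ (Y.max' hYne) with hM
  -- the K interpolation nodes: `τ` on `Y`, then fresh points above everything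
  let t : Fin K → ℝ := fun i => if h : (i : ℕ) < kY then τ (e ⟨i, h⟩) else M + 1 + i
  have hle : ∀ i (h : (i : ℕ) < kY), τ (e ⟨i, h⟩) ≤ M := fun i h =>
    hτ.monotone (Finset.le_max' Y _ (Y.orderEmbOfFin_mem rfl _))
  have ht : Function.Injective t := by
    intro i i' hii'
    simp only [t] at hii'
    by_cases h : (i : ℕ) < kY <;> by_cases h' : (i' : ℕ) < kY
    · rw [dif_pos h, dif_pos h'] at hii'
      have := e.injective (hτ.injective hii')
      exact Fin.ext (by simpa using congrArg Fin.val this)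
    · rw [dif_pos h, dif_neg h'] at hii'
      have := hle i h; have : (0 : ℝ) ≤ (i' : ℕ) := Nat.cast_nonneg _; linarith
    · rw [dif_neg h, dif_pos h'] at hii'
      have := hle i' h'; have : (0 : ℝ) ≤ (i : ℕ) := Nat.cast_nonneg _; linarith
    · rw [dif_neg h, dif_neg h'] at hii'
      exact Fin.ext (by exact_mod_cast (by linarith : ((i : ℕ) : ℝ) = i'))
  -- target values: `b` on `A`, `0` elsewhere
  let v : Fin K → ℝ := fun i => if h : (i : ℕ) < kY then b (e ⟨i, h⟩) else 0
  obtain ⟨c, hc⟩ := exists_expSum_interpolate δ hd.injective t ht v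
  -- every `y ∈ Y` is some `e ⟨i, _⟩`
  have hsurj : ∀ y ∈ Y, ∃ i : Fin kY, e i = y := fun y hy => by
    have : y ∈ Set.range e := by rw [Finset.range_orderEmbOfFin]; exact hy
    exact this
  have hval : ∀ y ∈ Y, ∑ l, c l * Real.exp (δ l * τ y) = b y := by
    intro y hy
    obtain ⟨i, rfl⟩ := hsurj y hy
    have hi : ((Fin.castLE hYcard i : Fin K) : ℕ) < kY := by simp
    have h1 := hc (Fin.castLE hYcard i)
    simp only [t, v, dif_pos hi, Fin.val_castLE, Fin.eta] at h1
    exact h1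
  have hZ : ∀ i ∈ Z, ∑ l, c l * Real.exp (δ l * τ i) = 0 := fun i hi => by
    rw [hval i (Finset.mem_union_right _ hi)]
    exact hbA i (Finset.disjoint_right.1 hAZ hi)
  have hsum := hpair c hZ
  have hsq : ∑ j, b j * (∑ l, c l * Real.exp (δ l * τ j)) = ∑ j, b j * b j := by
    refine Finset.sum_congr rfl fun j _ => ?_
    by_cases hj : j ∈ A
    · rw [hval j (Finset.mem_union_left _ hj)]
    · rw [hbA j hj, zero_mul, zero_mul]
  rw [hsq] at hsum
  have hz := (Finset.sum_eq_zero_iff_of_nonneg (fun j _ => mul_self_nonneg (b j))).1 hsum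
  intro j
  exact mul_self_eq_zero.1 (hz j (Finset.mem_univ j))

end Summit.ValiantsHypothesis.ValiantsHypothesis.Theorems.LacunarySymmetroidMatrixDescartes.WallBubbling
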